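import Summits.PneNP.PneNP.Theorems.ExpanderLinearGeneratorsLinearGeneratorModPFregeHardPolyCalcSize
import Literature.Computability.MetaComplexity.PolynomialCalculusMultilinearCompleteness
import HarnessLib

/-!
# Non-vacuity of the polynomial calculus size rung (item stmt-PneNP-11444)

Companion of `…LinearGeneratorModPFregeHardPolyCalcSize.lean` (the PC-size rung under the
`AC⁰[p]`-Frege crux `LinearGeneratorModPFregeHard` of route `ExpanderLinearGenerators`): that file
bounds from below the number of monomials of EVERY refutation, in the polynomial calculus with the
variable rule (multilinear form, `MLPC.Derivable`), of the clause polynomials of `sumEncoding 1 E`.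
Here we record that such refutations EXIST whenever `E` is unsolvable (the item's hypothesis), by
the completeness theorem `MLPC.exists_derivable_one_support_subset` of
`Literature/…/PolynomialCalculusMultilinearCompleteness.lean`:

* `boolUnsat_cnfPolys_of_not_systemSat` — the clause polynomials of an unsolvable system have no
  common Boolean zero (`sumEncoding_satisfiable_iff` + the semantics `eval_unsatPolyK`);
* `exists_mlpc_refutation_of_not_systemSat` — hence a refutation using finitely many monomials
  exists, so the size bound of the rung speaks about a nonempty set of objects.

References: J. Krajíček, *Proof Complexity* (2019), §6.2 (completeness of PC)
[KrajicekProofComplexity2019]; C. Beck, R. Impagliazzo, S. Lovett 2017, Def. 5.6 [Beck2017].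
-/

noncomputable section

set_option linter.dupNamespace false -- `Summit.PneNP.PneNP.…`: summit = sub-problem (D-0017)

namespace Summit.PneNP.PneNP.Theorems.PolyCalc

open Finset MvPolynomial Literature.Computability.Complexity Literature.Computability.MetaComplexity

variable {K : Type*} [Field K] {n m : ℕ}

/-! ### Non-vacuity: unsolvable systems have refutations -/

/-- **The clause polynomials of an unsolvable system have no common Boolean zero.**
[Krajíček 2019, §6 (6.0.1); Beck 2017, Def. 5.6] [folklore] -/
theorem boolUnsat_cnfPolys_of_not_systemSat (E : Fin m → LinEqMod 2 n)
    (hunsat : ¬ SystemSat E Finset.univ) : MLPC.BoolUnsat K (cnfPolys K (sumEncoding 1 E)) := by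
  intro x
  have hx : (sumEncoding 1 E).eval x ≠ true := fun h =>
    hunsat ((sumEncoding_satisfiable_iff (p := 2) (B := 1) (by norm_num) Nat.one_pos E).1 ⟨x, h⟩)
  rw [CNF.eval, Ne, List.all_eq_true] at hx
  push Not at hx
  obtain ⟨C, hC, hCx⟩ := hx
  refine ⟨unsatPolyK K C, ⟨C, hC, rfl⟩, ?_⟩
  have hev := eval_unsatPolyK (K := K) x C
  have hfalse : C.eval x = false := by
    rw [Clause.eval]; simpa using hCx
  rw [hfalse] at hev
  change MvPolynomial.eval (fun v => if x v then (1 : K) else 0) (unsatPolyK K C) ≠ 0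
  rw [hev]
  exact one_ne_zero

/-- **Refutations exist for unsolvable systems**: the clause polynomials of `sumEncoding 1 E`,
`E` unsolvable, have a refutation in the polynomial calculus with the variable rule (multilinear
form) using finitely many monomials — so the size statements below quantify over a nonempty set.
[Krajíček 2019, §6.2 (completeness of PC); Clegg–Edmonds–Impagliazzo 1996] [folklore] -/
theorem exists_mlpc_refutation_of_not_systemSat (E : Fin m → LinEqMod 2 n)
    (hunsat : ¬ SystemSat E Finset.univ) :
    ∃ M : Finset (ℕ →₀ ℕ), MLPC.Derivable (cnfPolys K (sumEncoding 1 E)) (fun g => g.support ⊆ M) 1 := by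
  classical
  -- any degree bound works; take the maximal support size `n`
  refine MLPC.exists_derivable_one_support_subset (V := Finset.range n) (d₀ := n)
    (fun g hg => vars_subset_range_of_mem_cnfPolys E hg) (fun g hg => ?_)
    (boolUnsat_cnfPolys_of_not_systemSat E hunsat)
  exact totalDegree_le_of_mem_cnfPolys E (fun i => (Finset.card_le_univ _).trans (by simp)) hg

end Summit.PneNP.PneNP.Theorems.PolyCalc
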